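import Summits.QuantumFields.YangMills.Theorems.LuscherReductionTwistedTraceScalingInnerOfSoftTube
import Summits.QuantumFields.YangMills.Theorems.LuscherReductionTwistedTraceScalingPolarMean
import Summits.QuantumFields.YangMills.Theorems.LuscherReductionTwistedTraceScalingInnerVacuumSplit
import HarnessLib

/-!
# The WEIGHT OF RECORD for the C4-CORE gauge slice: fat admissible tube × Gaussian concentration in the vacuum gauge-linear coordinate — and the
# resulting ONE-LINE target `SoftTubeNoIntruderAt L (recordWeight L δ δg)` for C4 INNER ONE-ORBIT
# (lane A of S-BASE, crux `TwistedTraceScaling` stmt-QuantumFields-20203, sub-target C4 INNER; design note `pub/ym-fleet/ym-luscher-20007-p1/COARSE-DESIGN.md` §23.4)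

* `vacGrad L φ` — the linearised gauge mode `(φ(y) − φ(x))_{e = (x → y)}` of a site field `φ : sites → ℝ³` (tree: `gradient_mem_ker_covCurl_one`), `gaugeModes L` its range in
  `LinkSpace L`; `relLinkVec L U ∈ LinkSpace L` — the EXPLICIT transverse coordinate of `U`, `(U_e · p_{dir e}(U)⁻¹)⃗` (polar mean `…PolarMean`);
  `gaugeCoordSq L U = ‖P_Γ(relLinkVec L U)‖²` — squared norm of its orthogonal projection onto the gauge modes (`Submodule.starProjection`).
* `fatTube L δ β = nearOne (2δ(β)) ∩ {orbitDist < δ(β)}`; ★ `recordWeight L δ δg β U = 𝟙_{fatTube}(U) · exp(−gaugeCoordSq L U / δg(β)²)`.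
* measurability (`measurable_gaugeCoordSq`, via `measurable_quatToSU2` and continuity of the direction sums), `0 ≤ gaugeCoordSq ≤ |E|`, hence
  `exp(−|E|/δg²) ≤ w ≤ 1`;
* ★★ `softTubeAdmissible_of_sandwich'` — the sandwich criterion of `…InnerOfSoftTube` with a β-DEPENDENT fatness radius `ρ(β)` (`δ β ≤ ρ β/2`);
* ★★★ `softTubeAdmissible_recordWeight : (∀ β, 0 < δ β) → (∀ β, 0 < δg β) → SoftTubeAdmissible L δ (recordWeight L δ δg)`;
* ★★★ `innerNoIntruderOneOrbitAt_of_recordWeight : SoftTubeNoIntruderAt L (recordWeight L δ δg) → InnerNoIntruderOneOrbitAt L δ` — C4-CORE at radius `δ` is now ONE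
  min–max statement for the bi-invariant averaged kernel `avgKernel` on `L²(fatTube, (N/χ) dU)` over arbitrary bounded measurable families, for ANY positive scales
  `δ, δg` (record: `δ = powScale s`, `s ∈ (1/6, 1/5)`; `δg = powScale (1/2 + s')`).
HONEST FRAMING: definitions + exact reduction bookkeeping for a stub of a child of the CONDITIONAL reduction route R2b1; `SoftTubeNoIntruderAt L (recordWeight …)` is
OPEN (it is C4-CORE); not infinite volume, not a gap, not Clay.
-/

set_option autoImplicit false

noncomputable section

open MeasureTheory Filter Topology Real
open scoped BigOperators Quaternion
open Literature.MathematicalPhysics.QuantumFieldTheory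
open Literature.MathematicalPhysics.QuantumLattice
open Literature.MathematicalPhysics.QuantumFieldTheory.Balaban1983to89.T4CubeChartGnomonic (qI qJ qK)

attribute [local instance] Literature.Analysis.FluidPDE.Tao2016.quatMeasurableSpace
  Literature.Analysis.FluidPDE.Tao2016.quatBorelSpace

namespace Summit.QuantumFields.YangMills.Theorems.FemtoTransferGap

open TwoLattice TwoLattice.Avg TwoLattice.ConstTube TwoLattice.Stiff TwoLattice.Cov TwoLattice.Toron

variable (L : ℕ) [NeZero L]

/-! ## §1 The vacuum gauge modes and the gauge-linear coordinate -/

/-- **The linearised gauge mode** of a site field `φ : sites → ℝ³`: `(vacGrad φ)_{(e,a)} = φ(y)_a − φ(x)_a` for the link `e` from `x` to `y`. [cite: Luscher1983, §3] -/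
def vacGrad : (Site 3 L → Fin 3 → ℝ) →ₗ[ℝ] LinkSpace L where
  toFun φ := WithLp.toLp 2 fun ea : Edge 3 L × Fin 3 => φ (ea.1.1.shift ea.1.2) ea.2 - φ ea.1.1 ea.2
  map_add' φ ψ := by
    ext ea
    simp only [WithLp.ofLp_add, Pi.add_apply]
    ring
  map_smul' c φ := by
    ext ea
    simp only [WithLp.ofLp_smul, Pi.smul_apply, smul_eq_mul, RingHom.id_apply]
    ring

/-- **The vacuum gauge modes** `Γ = range(vacGrad)` — a subspace of `ker(covCurl 1)` (`gradient_mem_ker_covCurl_one`). [cite: Luscher1983, §3] -/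
def gaugeModes : Submodule ℝ (LinkSpace L) := LinearMap.range (vacGrad L)

omit [NeZero L] in
/-- The gauge modes are zero modes of the vacuum curl. [cite: Luscher1983, §3] -/
theorem gaugeModes_le_ker : gaugeModes L ≤ LinearMap.ker (covCurl (1 : GaugeConfig 3 L SU2)) := by
  rintro v ⟨φ, rfl⟩
  exact gradient_mem_ker_covCurl_one φ

/-- **The explicit transverse coordinate** of a configuration: the vector parts of the relative links against the polar means,
`(relLinkVec U)_{(e,a)} = (U_e · p_{dir e}(U)⁻¹)⃗_a`. [folklore] -/
def relLinkVec (U : GaugeConfig 3 L SU2) : LinkSpace L := WithLp.toLp 2 fun ea : Edge 3 L × Fin 3 => vecPart (U ea.1 * (polarMean L ea.1.2 U)⁻¹) ea.2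

/-- **The squared gauge-linear coordinate** `‖P_Γ(relLinkVec U)‖²`. [folklore] -/
def gaugeCoordSq (U : GaugeConfig 3 L SU2) : ℝ := ‖(gaugeModes L).starProjection (relLinkVec L U)‖ ^ 2

/-- `0 ≤ gaugeCoordSq`. [folklore] -/
theorem gaugeCoordSq_nonneg (U : GaugeConfig 3 L SU2) : 0 ≤ gaugeCoordSq L U := by unfold gaugeCoordSq; positivity

/-- `‖relLinkVec U‖² ≤ |E|` (every relative link has `|vector part|² ≤ 1`). [folklore] -/
theorem norm_relLinkVec_sq_le (U : GaugeConfig 3 L SU2) : ‖relLinkVec L U‖ ^ 2 ≤ Fintype.card (Edge 3 L) := by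
  rw [EuclideanSpace.norm_sq_eq, Fintype.sum_prod_type]
  simp only [relLinkVec, Real.norm_eq_abs, sq_abs]
  calc ∑ e : Edge 3 L, ∑ a : Fin 3, vecPart (U e * (polarMean L e.2 U)⁻¹) a ^ 2 ≤ ∑ _e : Edge 3 L, (1 : ℝ) :=
        Finset.sum_le_sum fun e _ => sum_vecPart_sq_le _
    _ = Fintype.card (Edge 3 L) := by rw [Finset.sum_const, Finset.card_univ, nsmul_eq_mul, mul_one]

/-- `gaugeCoordSq U ≤ |E|` (the projection is norm non-increasing). [folklore] -/
theorem gaugeCoordSq_le (U : GaugeConfig 3 L SU2) : gaugeCoordSq L U ≤ Fintype.card (Edge 3 L) := by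
  have h1 := (gaugeModes L).norm_starProjection_apply_le (relLinkVec L U)
  have h2 := norm_relLinkVec_sq_le L U
  unfold gaugeCoordSq
  nlinarith [norm_nonneg ((gaugeModes L).starProjection (relLinkVec L U)), norm_nonneg (relLinkVec L U)]

/-! ## §2 Measurability -/

/-- The direction quaternion sum as a linear combination of `1, i, j, k`. [folklore] -/
theorem dirQuat_eq_lincomb (k : Fin 3) (U : GaugeConfig 3 L SU2) :
    dirQuat L k U = (dirScalarSum L k U : ℝ) • (1 : ℍ) + dirVecSum L k U 0 • qI + dirVecSum L k U 1 • qJ + dirVecSum L k U 2 • qK := by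
  ext <;> simp [dirQuat, qI, qJ, qK]

/-- `U ↦ M_k(U)` is continuous. [folklore] -/
theorem continuous_dirQuat (k : Fin 3) : Continuous fun U : GaugeConfig 3 L SU2 => dirQuat L k U := by
  have hs : Continuous fun U : GaugeConfig 3 L SU2 => dirScalarSum L k U := by
    unfold dirScalarSum
    exact continuous_finsetSum _ fun x _ => continuous_scalarPart.comp (continuous_apply _)
  have hv : ∀ a : Fin 3, Continuous fun U : GaugeConfig 3 L SU2 => dirVecSum L k U a := fun a => by
    unfold dirVecSum
    have h : (fun U : GaugeConfig 3 L SU2 => (∑ x : Site 3 L, vecPart (U (x, k))) a) =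
        fun U => ∑ x : Site 3 L, vecPart (U (x, k)) a := funext fun U => Finset.sum_apply _ _ _
    rw [h]
    exact continuous_finsetSum _ fun x _ => (continuous_apply a).comp (continuous_vecPart.comp (continuous_apply _))
  simp_rw [dirQuat_eq_lincomb]
  fun_prop

/-- `U ↦ p_k(U)` is measurable. [folklore] -/
theorem measurable_polarMean (k : Fin 3) : Measurable fun U : GaugeConfig 3 L SU2 => polarMean L k U := by
  haveI : SecondCountableTopology SU2 := secondCountableTopology_su2
  unfold polarMean
  exact measurable_quatToSU2.comp (continuous_dirQuat L k).measurable

/-- `U ↦ relLinkVec U` is measurable. [folklore] -/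
theorem measurable_relLinkVec : Measurable (relLinkVec L) := by
  haveI : SecondCountableTopology SU2 := secondCountableTopology_su2
  have h : Measurable fun U : GaugeConfig 3 L SU2 => fun ea : Edge 3 L × Fin 3 => vecPart (U ea.1 * (polarMean L ea.1.2 U)⁻¹) ea.2 := by
    refine measurable_pi_lambda _ fun ea => ?_
    exact (continuous_apply ea.2).measurable.comp
      (continuous_vecPart.measurable.comp ((measurable_pi_apply ea.1).mul (measurable_polarMean L ea.1.2).inv))
  exact (MeasurableEquiv.toLp 2 (Edge 3 L × Fin 3 → ℝ)).measurable.comp h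

/-- `gaugeCoordSq` is measurable. [folklore] -/
theorem measurable_gaugeCoordSq : Measurable (gaugeCoordSq L) := by
  unfold gaugeCoordSq
  exact ((gaugeModes L).starProjection.continuous.measurable.comp (measurable_relLinkVec L)).norm.pow_const 2

/-! ## §3 The weight of record and its admissibility -/

/-- **The fat tube** at radius `δ`: links within `2δ(β)` of `1` and orbit distance `< δ(β)`. [folklore] -/
def fatTube (δ : ℝ → ℝ) (β : ℝ) : Set (GaugeConfig 3 L SU2) := nearOne L (2 * δ β) ∩ {W | orbitDist W < δ β}

/-- The fat tube is measurable. [folklore] -/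
theorem measurableSet_fatTube (δ : ℝ → ℝ) (β : ℝ) : MeasurableSet (fatTube L δ β) :=
  (measurableSet_nearOne L _).inter (measurableSet_lt measurable_orbitDist measurable_const)

/-- ★ **THE WEIGHT OF RECORD**: `χ_β(U) = 𝟙_{fatTube δ β}(U) · exp(−gaugeCoordSq U / δg(β)²)` — fat admissible tube × Gaussian concentration on the vacuum gauge slice
`P_Γ(relLinkVec U) = 0` at width `δg(β)`. [cite: Luscher1983, §3] -/
def recordWeight (δ δg : ℝ → ℝ) (β : ℝ) (U : GaugeConfig 3 L SU2) : ℝ :=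
  (fatTube L δ β).indicator (fun _ => (1 : ℝ)) U * Real.exp (-(gaugeCoordSq L U / δg β ^ 2))

/-- The Gaussian factor is measurable. [folklore] -/
theorem measurable_gaussFactor (δg : ℝ → ℝ) (β : ℝ) : Measurable fun U : GaugeConfig 3 L SU2 => Real.exp (-(gaugeCoordSq L U / δg β ^ 2)) :=
  (((measurable_gaugeCoordSq L).div_const _).neg).exp

/-- The Gaussian factor is at most `1`. [folklore] -/
theorem gaussFactor_le_one (δg : ℝ → ℝ) (β : ℝ) (U : GaugeConfig 3 L SU2) : Real.exp (-(gaugeCoordSq L U / δg β ^ 2)) ≤ 1 := by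
  rw [Real.exp_le_one_iff, neg_nonpos]
  exact div_nonneg (gaugeCoordSq_nonneg L U) (sq_nonneg _)

/-- The Gaussian factor is at least `exp(−|E|/δg²)`. [folklore] -/
theorem gaussFactor_ge (δg : ℝ → ℝ) (β : ℝ) (U : GaugeConfig 3 L SU2) :
    Real.exp (-((Fintype.card (Edge 3 L) : ℝ) / δg β ^ 2)) ≤ Real.exp (-(gaugeCoordSq L U / δg β ^ 2)) := by
  rw [Real.exp_le_exp, neg_le_neg_iff]
  exact div_le_div_of_nonneg_right (gaugeCoordSq_le L U) (sq_nonneg _)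

/-- ★★ **Sandwich admissibility with a β-dependent fatness radius**: `χ β = 𝟙_{T β}·w β`, `nearOne (ρ β) ∩ {orbitDist < δ β} ⊆ T β ⊆ {orbitDist < δ β}`, `δ β ≤ ρ β / 2`,
`0 < ρ β`, `m β ≤ w β ≤ 1`, `0 < m β` ⇒ `SoftTubeAdmissible L δ χ`. [folklore] -/
theorem softTubeAdmissible_of_sandwich' {δ ρ : ℝ → ℝ} {T : ℝ → Set (GaugeConfig 3 L SU2)} (hTm : ∀ β, MeasurableSet (T β)) (hρ : ∀ β, 0 < ρ β)
    (h : ∀ β : ℝ, δ β ≤ ρ β / 2 ∧ nearOne L (ρ β) ∩ {W | orbitDist W < δ β} ⊆ T β ∧ T β ⊆ {W | orbitDist W < δ β})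
    {w : ℝ → GaugeConfig 3 L SU2 → ℝ} (hwm : ∀ β, Measurable (w β)) {m : ℝ → ℝ} (hm : ∀ β, 0 < m β) (hmw : ∀ β U, m β ≤ w β U) (hw1 : ∀ β U, w β U ≤ 1) :
    SoftTubeAdmissible L δ fun β => fun U => (T β).indicator (fun _ => (1 : ℝ)) U * w β U := by
  have hχm : ∀ β, Measurable fun U => (T β).indicator (fun _ => (1 : ℝ)) U * w β U := fun β =>
    (measurable_const.indicator (hTm β)).mul (hwm β)
  have hχb : ∀ β U, |(T β).indicator (fun _ => (1 : ℝ)) U * w β U| ≤ 1 := fun β U => by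
    have h0 : 0 ≤ w β U := (hm β).le.trans (hmw β U)
    by_cases hU : U ∈ T β
    · rw [Set.indicator_of_mem hU, one_mul, abs_of_nonneg h0]; exact hw1 β U
    · rw [Set.indicator_of_notMem hU, zero_mul, abs_zero]; exact zero_le_one
  have hdom : ∀ β U, m β * tubeWeight (T β) U ≤ gaugeAvg (fun U => (T β).indicator (fun _ => (1 : ℝ)) U * w β U) U := fun β U => by
    rw [tubeWeight, ← gaugeAvg_const_mul]
    refine gaugeAvg_mono ((measurable_const.indicator (hTm β)).const_mul _) (hχm β) (C := |m β| * 1) (D := 1)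
      (fun V => by rw [abs_mul]; exact mul_le_mul_of_nonneg_left (abs_indicator_one_le (T β) V) (abs_nonneg _)) (hχb β) (fun V => ?_) U
    by_cases hV : V ∈ T β
    · rw [Set.indicator_of_mem hV, mul_one, one_mul]; exact hmw β V
    · rw [Set.indicator_of_notMem hV, mul_zero, zero_mul]
  refine ⟨hχm, fun β => ⟨1, hχb β⟩, 0, fun β _ => ?_⟩
  obtain ⟨hδρ, hsub, hsup⟩ := h β
  have hball : 0 < (gaugeMeasure L).real (gaugeBall L (ρ β / 4)) :=
    ENNReal.toReal_pos (gaugeMeasure_gaugeBall_pos L (by linarith [hρ β])).ne' (measure_ne_top _ _)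
  have hlow : ∀ U, orbitDist U < δ β → m β * (gaugeMeasure L).real (gaugeBall L (ρ β / 4)) ≤
      gaugeAvg (fun U => (T β).indicator (fun _ => (1 : ℝ)) U * w β U) U := fun U hU =>
    (mul_le_mul_of_nonneg_left (tubeWeight_ge_of_subset L (hTm β) hδρ hsub hU) (hm β).le).trans (hdom β U)
  refine ⟨fun U hU => (mul_pos (hm β) hball).trans_le (hlow U hU), m β * (gaugeMeasure L).real (gaugeBall L (ρ β / 4)), mul_pos (hm β) hball, fun U hU => ?_⟩
  have hUT : U ∈ T β := by
    by_contra h'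
    exact hU (show (T β).indicator (fun _ => (1 : ℝ)) U * w β U = 0 by rw [Set.indicator_of_notMem h', zero_mul])
  exact hlow U (hsup hUT)

/-- ★★★ **THE WEIGHT OF RECORD IS ADMISSIBLE** for every positive radius function `δ` and width `δg`. [folklore] -/
theorem softTubeAdmissible_recordWeight {δ δg : ℝ → ℝ} (hδ : ∀ β, 0 < δ β) :
    SoftTubeAdmissible L δ (recordWeight L δ δg) := by
  have h := softTubeAdmissible_of_sandwich' L (δ := δ) (ρ := fun β => 2 * δ β) (T := fatTube L δ) (measurableSet_fatTube L δ)
    (fun β => by have := hδ β; positivity) (fun β => ⟨by linarith [hδ β], subset_rfl, Set.inter_subset_right⟩)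
    (w := fun β U => Real.exp (-(gaugeCoordSq L U / δg β ^ 2))) (measurable_gaussFactor L δg)
    (m := fun β => Real.exp (-((Fintype.card (Edge 3 L) : ℝ) / δg β ^ 2))) (fun β => Real.exp_pos _) (gaussFactor_ge L δg) (gaussFactor_le_one L δg)
  exact h

/-! ## §4 ★★★ C4 INNER ONE-ORBIT in one line -/

/-- ★★★ **C4-CORE at radius `δ` is the soft tube statement for the weight of record**:
`SoftTubeNoIntruderAt L (recordWeight L δ δg) → InnerNoIntruderOneOrbitAt L δ` for all positive `δ, δg`. [cite: Luscher1983, §3] -/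
theorem innerNoIntruderOneOrbitAt_of_recordWeight {δ δg : ℝ → ℝ} (hδ : ∀ β, 0 < δ β) (h : SoftTubeNoIntruderAt L (recordWeight L δ δg)) :
    InnerNoIntruderOneOrbitAt L δ :=
  innerNoIntruderOneOrbitAt_of_softTube (softTubeAdmissible_recordWeight L hδ) h

/-- ★★★ The instance of record: core radius `β^{-s}`, gauge width `β^{-t}` (any `s, t`; record `s ∈ (1/6, 1/5)`, `t = 1/2 + s'`). [cite: Luscher1983, §3] -/
theorem innerNoIntruderOneOrbitAt_pow_of_recordWeight (s t : ℝ) (h : SoftTubeNoIntruderAt L (recordWeight L (powScale s) (powScale t))) :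
    InnerNoIntruderOneOrbitAt L (powScale s) :=
  innerNoIntruderOneOrbitAt_of_recordWeight L (fun β => powScale_pos s β) h

end Summit.QuantumFields.YangMills.Theorems.FemtoTransferGap

end
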